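import Mathlib.NumberTheory.Cyclotomic.Basic
import Literature.NumberTheory.EllipticCurves.Kobayashi2003.SignedSelmer
import Literature.NumberTheory.EllipticCurves.GlobalMinimalModel
import Literature.NumberTheory.EllipticCurves.Tamagawa
import Literature.NumberTheory.EllipticCurves.GaloisAction
import HarnessLib

/-!
# Kitajima–Otsuki 2018, Main Theorem 1.3 (= Thm. 4.8) for `F = ℚ`, sign `+`:
# `X⁺(E/ℚ(μ_{p^∞}))` has no non-trivial finite `Λ`-submodule (`E/ℚ`, `p` odd supersingular, `a_p = 0`)

Topic `Literature/NumberTheory/EllipticCurves`, cluster `KitajimaOtsuki2018` (one paper, one result;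
namespace = path). It hangs off the signed Selmer vocabulary of `Kobayashi2003/SignedSelmer.lean`
(Kobayashi's Def. 1.1 / 2.1: `E^±(K_{n,v})`, `Sel^±(E/K_n)`, `Sel^±(E/K_∞)` over the layers of a
`ℤ_p`-extension `κ` of a number field `K`, and the Pontryagin-dual hypothesis structure
`SignedSelmerDualData W κ γ ε`). ONE NAMED FACT (`def … : Prop`, nothing asserted, D-0014; net
debt +1), the generalisation of B. D. Kim's theorem on finite `Λ`-submodules (J. Aust. Math. Soc.
95 (2013) Thm. 1.1, `p` UNRAMIFIED in the base) to the base field `F_0 = ℚ(μ_p)`, in which `p`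
ramifies — exactly Kobayashi's own tower `K_n = ℚ(ζ_{p^{n+1}})`.

HONEST FRAMING (BSD rank-`≤ 1` residual cell `b2b-bsdres`, seat additive-p4, gen 8, line V18): the
consumer is the research route on the CONSTRUCTION-SHAPED class X4 at `p = 3` (additive pairs whose
twist by `−3` is good supersingular with `a₃ = 0`), where — no exact `Γ`-Euler characteristic for
the signed Selmer groups being in print over the ramified base `ℚ(μ₃)` — the rank-`0` bound is
obtained from control INJECTIVITY plus THIS fact (`X⁺[T]` finite ⇒ `X⁺[T] = 0`). No label of the
cell moves; nothing is booked; this is not "finishing BSD".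

## Source, read at the page (held copy `paper:arxiv-1607.03612` = arXiv:1607.03612v1, the
## preprint of Tokyo J. Math. 41 (2018) 273–303, doi:10.3836/tjm/1502179270; numbering of the arXiv
## version)

T. Kitajima, R. Otsuki, *On the plus and the minus Selmer groups for elliptic curves at
supersingular primes* [KitajimaOtsuki2018]. §2 (arXiv p. 6): "We denote `F_n = F(μ_{p^{n+1}})`,
`F_{−1} = F` and `F_∞ = ∪_n F_n` … Throughout this paper, we fix the following notations: `p` is an
odd prime number, `F` is a finite extension of `ℚ`, `E` is an elliptic curve defined over a subfield
`F'` of `F`. Denote `S_p^{ss}` the set of all primes of `F'` lying above `p` where `E` has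
supersingular reduction. Throughout this paper, we assume the following: `E` has good reduction at
any prime `w | p` of `F'`; `S_p^{ss}` is nonempty; any prime `w ∈ S_p^{ss}` is unramified in `F`;
`F'_w = ℚ_p` for any prime `w ∈ S_p^{ss}` …; `a_w = 1 + p − #Ẽ_w(𝔽_p) = 0` for any prime
`w ∈ S_p^{ss}`. … **Definition 2.1.** (1) For a prime `v ∈ S^{ss}_{p,F}` and `n ≥ −1`, let `F_{n,v}`
be the completion of `F_n` at the unique prime of `F_n` lying above `v`. We define
`E⁺(F_{n,v}) = {P ∈ E(F_{n,v}) | Tr_{n/m+1} P ∈ E(F_{m,v}) for all even m, −1 ≤ m ≤ n−1}`,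
`E⁻(F_{n,v}) = {P ∈ E(F_{n,v}) | Tr_{n/m+1} P ∈ E(F_{m,v}) for all odd m, −1 ≤ m ≤ n−1}` where
`Tr_{n/m+1} : E(F_{n,v}) → E(F_{m+1,v})` is the trace map. (2) The plus and the minus Selmer groups
are defined by `Sel^±(F_n, E[p^∞]) := Ker( Sel(F_n, E[p^∞]) → ⊕_{v ∈ S^{ss}_{p,F}} H¹(F_{n,v},
E[p^∞]) / E^±(F_{n,v}) ⊗ ℚ_p/ℤ_p )`, `Sel^±(F_∞, E[p^∞]) := lim→_n Sel^±(F_n, E[p^∞])`. We denote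
the Pontryagin dual of a module `M` by `M^∨`. Let `𝒢_∞ = Gal(F_∞/F)`. Then … `Λ(𝒢_∞) :=
ℤ_p[[𝒢_∞]]` [acts] on `Sel^±(F_∞, E[p^∞])^∨`. … `Sel^±(F_∞, E[p^∞])^∨` is known to be
`Λ(𝒢_∞)`-torsion in the case `F = ℚ` (cf. [Kob03] Theorem 2.2)." Introduction (arXiv p. 3), with
`Λ = ℤ_p[[Gal(F_∞/F_0)]]`: "**Main Theorem 1.3** (Theorem 4.8). Let `F` be a finite extension of
`ℚ`, `F_0 = F(μ_p)`, `F_∞/F_0` the cyclotomic `ℤ_p`-extension, and `E` an elliptic curve defined over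
a subfield `F'` of `F`. … Assume the following conditions: (i) `E` has good reduction at any prime of
`F'` lying above `p`, (ii) `S_p^{ss}` is nonempty, (iii) any prime `w ∈ S_p^{ss}` is unramified in
`F`, (iv) `F'_w = ℚ_p` for any prime `w ∈ S_p^{ss}` …, (v) `a_w = 1 + p − #Ẽ_w(𝔽_p) = 0` for any
prime `w ∈ S_p^{ss}` …, and (vi) both `Sel^±(F_∞, E[p^∞])^∨` are `Λ`-torsion. Then both
`Sel^±(F_∞, E[p^∞])^∨` have no nontrivial finite `Λ`-submodule." Remark 1.4 (5) (arXiv p. 4): "In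
some cases, `Sel^±(F_∞, E[p^∞])^∨` is actually known to be `Λ`-torsion. For example, let `F_0` be a
finite abelian extension of `ℚ`, and `F_∞/F_0` the cyclotomic `ℤ_p`-extension. Suppose that `E` is
defined over `ℚ` and has supersingular reduction at `p` with `a_p = 0`. In this case, one can
actually show that `Sel^±(F_∞, E[p^∞])^∨` is `Λ`-torsion. Our main theorem implies that
`Sel^±(F_∞, E[p^∞])^∨` has no nontrivial finite `Λ`-submodule for any finite abelian field `F_0`."

## Transcription (the case `F = F' = ℚ`, so `F_0 = ℚ(μ_p)`, `F_∞ = ℚ(μ_{p^∞})`; sign `+` only — a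
## SPECIAL CASE of the printed statement; flag for the referee `KO18-F=Q-Rem14(5)`)

* For `F = F' = ℚ` conditions (i)–(v) read: `E/ℚ` has good reduction at `p` (i), supersingular at
  `p` (ii) — implied by (v) `a_p = 0` for `p` odd —, (iii)/(iv) are empty (`F = ℚ`, `F'_p = ℚ_p`), and
  (v) `a_p = 0`. Condition (vi) is DISCHARGED IN PRINT for `F = ℚ`: §2 p. 6 ("known to be
  `Λ(𝒢_∞)`-torsion in the case `F = ℚ` (cf. [Kob03] Theorem 2.2)") and Remark 1.4 (5) (for `E/ℚ`,
  `a_p = 0` and any finite abelian `F_0 ⊇ ℚ(μ_p)`: "Our main theorem implies that `Sel^±(F_∞,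
  E[p^∞])^∨` has no nontrivial finite `Λ`-submodule"). The transcription nevertheless KEEPS the
  finite generation and torsion of `X⁺` as displayed hypotheses (a weakening; they are Kobayashi's
  Thm. 2.2, delivered by the sibling fact `Kobayashi2003.thm41_plusCharIdeal_dvd_cyclotomicThree` at
  `p = 3`), so that nothing beyond the printed conclusion for the sign `+` is used.
* `F_0 = ℚ(μ_p)`: any `K` with `IsCyclotomicExtension {p} ℚ K`; `F_∞/F_0` = the cyclotomic
  `ℤ_p`-extension `κ` of `K` (`κ.IsCyclotomic`), whose `n`-th layer is `ℚ(μ_{p^{n+1}}) = F_n`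
  (`[F_n : F_0] = pⁿ`), with a topological generator `γ` (`Λ = ℤ_p⟦T⟧`, `T = γ − 1`); `E` over
  `F_0` = any `K`-model `V'` of `E_K` (`C • V.baseChange K = V'`; Selmer groups and trace conditions
  are invariant under `K`-isomorphism).
* `Sel⁺(F_∞, E[p^∞])` = the tree's `Kobayashi2003.signedSelmerInfty V' κ 1`: `F_0` has ONE prime
  above `p`, and Def. 2.1's PLUS condition "for all even `m`, `−1 ≤ m ≤ n − 1`" involves exactly the
  even `m` with `0 ≤ m < n` — the tree's `signedLocalPointsOfEmb … 1 n` ("`∀ m < n, (−1)^m = 1 →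
  Tr_{n/m+1} P ∈ E(K_m·K_v)`"); the MINUS condition of Def. 2.1 contains the extra clause `m = −1`
  (`Tr_{n/0} P ∈ E(ℚ_p)`), which is NOT the tree's `ε = −1` object over the base `K = F_0` — hence
  only the sign `+` is transcribed. `Sel⁺(F_∞, E[p^∞])^∨` with its `Λ`-action = any
  `D : SignedSelmerDualData V' κ γ 1` (exists and is unique up to `Λ`-isomorphism:
  `SignedSelmerDualExistsProofs`, `SignedSelmerDualUniquenessProofs`).
* "has no nontrivial finite `Λ`-submodule" = `∀ N : Submodule Λ D.X, Finite N → N = ⊥`.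

What is NOT here: `F ≠ ℚ`, the sign `−`, Main Theorem 1.7 / Thm. 1.8 (the local structure of
`(E^±(k_∞) ⊗ ℚ_p/ℤ_p)^∨`), any proof. TODO(general form): `F` any number field with `p` unramified,
`E` over `F' ⊆ F` with `F'_w = ℚ_p`, both signs, as printed.

Consumer: `Summits/BirchSwinnertonDyer/Rank1Residual/Additive/SignedSelmerControlZero.lean`
(hypothesis `hnf`) and `…/Additive/XGssRankZeroCyclotomicThree*.lean` (line V18, `p = 3`).
-/

set_option autoImplicit false

noncomputable section

open scoped Classical

open WeierstrassCurve Literature.NumberTheory.EllipticCurves Literature.NumberTheory.GaloisRepresentations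

namespace Literature.NumberTheory.EllipticCurves.KitajimaOtsuki2018

/-- **Kitajima–Otsuki 2018, Main Theorem 1.3 (= Thm. 4.8), case `F = F' = ℚ`, sign `+`: the
Pontryagin dual of `Sel⁺(ℚ(μ_{p^∞}), E[p^∞])` has no non-trivial finite `Λ`-submodule.** As printed
(arXiv:1607.03612 = Tokyo J. Math. 41 (2018), Main Thm. 1.3): "Let `F` be a finite extension of `ℚ`,
`F_0 = F(μ_p)`, `F_∞/F_0` the cyclotomic `ℤ_p`-extension, and `E` an elliptic curve defined over a
subfield `F'` of `F`. … Assume (i) `E` has good reduction at any prime of `F'` lying above `p`, (ii)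
`S_p^{ss}` is nonempty, (iii) any prime `w ∈ S_p^{ss}` is unramified in `F`, (iv) `F'_w = ℚ_p` for
any prime `w ∈ S_p^{ss}`, (v) `a_w = 1 + p − #Ẽ_w(𝔽_p) = 0` for any prime `w ∈ S_p^{ss}`, and (vi)
both `Sel^±(F_∞, E[p^∞])^∨` are `Λ`-torsion. Then both `Sel^±(F_∞, E[p^∞])^∨` have no nontrivial
finite `Λ`-submodule" (`p` odd; `Λ = ℤ_p[[Gal(F_∞/F_0)]]`; `Sel^±` as in Def. 2.1 — plus condition
"`Tr_{n/m+1} P ∈ E(F_{m,v})` for all even `m`, `−1 ≤ m ≤ n−1`"), with (vi) discharged in print for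
`F = ℚ` by §2 p. 6 ("known to be `Λ(𝒢_∞)`-torsion in the case `F = ℚ` (cf. [Kob03] Theorem 2.2)")
and Remark 1.4 (5) ("for any finite abelian field `F_0`"). Here, for `F = F' = ℚ`, `F_0 = ℚ(μ_p)`
(`IsCyclotomicExtension {p} ℚ K`), the sign `+`: for `E = V/ℚ` globally minimal with good reduction
at the odd prime `p` and `a_p = 0`, any `K`-model `V'` of `E_K`, `κ` the cyclotomic `ℤ_p`-extension
of `K` (layers `ℚ(μ_{p^{n+1}}) = F_n`) with topological generator `γ`, and any Pontryagin-dual datum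
`D` of the tree's `Sel⁺(E/K_∞) = signedSelmerInfty V' κ 1` (= Def. 2.1's `Sel⁺(F_∞, E[p^∞])`: one
prime above `p`, plus condition at the even `m` with `0 ≤ m < n`) whose module `X⁺ = D.X` is
finitely generated and `Λ`-torsion (displayed hypotheses; Kobayashi Thm. 2.2): every finite
`Λ`-submodule of `X⁺` is trivial. Special case of print (sign `−`, general `F`, `F'` NOT
transcribed); named fact, nothing asserted.
[cite: KitajimaOtsuki2018, Main Thm. 1.3 (= Thm. 4.8) with Def. 2.1, §2 p. 6 and Remark 1.4 (5); corpus `paper:arxiv-1607.03612` p0003, p0004, p0006, p0019]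
[cite: Kobayashi2003, Thm. 2.2 (p. 5) (the torsion hypothesis (vi) for F = ℚ)] -/
def mainThm13_plusSelmerDual_noFiniteSubmodule : Prop :=
  ∀ (V : WeierstrassCurve ℚ) [V.IsElliptic] [V.IsGloballyMinimal] (p : ℕ) [Fact p.Prime],
    p ≠ 2 → V.HasGoodReductionAtPrime p → V.frobeniusTrace p = 0 →
    ∀ (K : Type) [Field K] [NumberField K] [IsCyclotomicExtension {p} ℚ K]
      (V' : WeierstrassCurve K) [V'.IsElliptic],
      (∃ C : VariableChange K, C • V.baseChange K = V') →
    ∀ (κ : ZpExtension K p) (γ : Field.absoluteGaloisGroup K),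
      κ.IsCyclotomic → κ.IsTopGenerator γ →
    ∀ (D : Kobayashi2003.SignedSelmerDualData V' κ γ 1) [Module.Finite (IwasawaAlgebra p) D.X],
      Module.IsTorsion (IwasawaAlgebra p) D.X →
      ∀ N : Submodule (IwasawaAlgebra p) D.X, Finite N → N = ⊥

end Literature.NumberTheory.EllipticCurves.KitajimaOtsuki2018

end
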